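import Summits.Schanuel.Schanuel.Theorems.ZilberEacFibreCurveAlgebraicCurve
import Summits.Schanuel.Schanuel.Theorems.ZilberEacFibreMinimalPolynomial
import Summits.Schanuel.Schanuel.Theorems.ZilberEacAlgebraicCurvesVerdict
import HarnessLib

/-!
# Arbitrary base branches, XCVI: EVERY SURFACE OF MANTOVA–MASSER'S CASE OVER A CURVE DEFINED OVER
# `ℚ̄` THAT IS A CYLINDER IN THE SECOND MULTIPLICATIVE COORDINATE HAS ZARISKI-DENSE EXPONENTIAL
# POINTS (O89 (a): surfaces fibred in `y₀`-curves)

HONEST FRAMING.  Cell `pub-schanuel` (Zilber's Exponential-Algebraic Closedness, case ladder;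
host summit Schanuel), seat 2, gen 33.  THE VERDICT of gen 32 (file LXXXVIII) covered the surfaces
`{F = 0, y₀ = R(x)}`; a general surface `W` of the case over `C : F = 0` whose equations do not
involve `y₁` is a cylinder `W = D × ℂ_{y₁}` over a curve `D ⊂ C × ℂ_{y₀}` (a surface "fibred in
`y₀`-curves").  **`unprojectedDense_of_mmCase_cylinder_algebraic`**: for every irreducible
`F ∈ ℚ̄[x₀][x₁]` and every `W` of Mantova–Masser's case with base curve `{F = 0}` such that
(i) `W` is invariant under changing `y₁` (`hcyl`) and (ii) some `P ∈ ℂ[x₀][x₁][y₀]` not all of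
whose coefficients are divisible by `F` vanishes on `W`, the unprojected exponential points are
Zariski dense in `W`.  Proof: the minimal fibre polynomial `P_W` of `𝔭 = I(W)` (file XCV:
`F ∤ lc`, `F ∤ P_W(·, 0)`, `F ∤ Disc_y`, and `P_W` divides every `y₁`-free element of `𝔭` modulo
`F`); `ℂ[x₀,x₁,y₀,y₁] = ℂ[x₀][x₁][y₀][y₁]` and the cylinder hypothesis put every `y₁`-coefficient
of every `G ∈ 𝔭` into `𝔭`, so `W ⊇ {x ∈ C, lc(x) ≠ 0, y₀ ≠ 0, P_W(x; y₀) = 0}` and file XCIII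
applies with `S = W`; lines are gen 18.  What this is NOT: surfaces whose equations involve `y₁`
(Mantova–Masser's exponential-polynomial regime) — OPEN; curves with transcendental
coefficients; Fib(3,2); EC(3,2) — OPEN; the question OPEN in general; NOT Schanuel's conjecture
(neither used nor implied; Lindemann enters through file LXXXIII); EAC ⇏ SC.
-/

noncomputable section

open Filter Topology Set Complex Polynomial
open Literature.NumberTheory.Transcendental Literature.ModelTheory.Zilber
open Literature.ModelTheory.ExponentialFields

set_option linter.dupNamespace false

namespace Summit.Schanuel.Schanuel.Theorems

section FibreCurveCylinder

/-! ## Part A. `ℂ[x₀][x₁][y₀]` inside `ℂ[x₀, x₁, y₀, y₁]` -/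

variable (ι : Polynomial ℂ[X][X] →+* MvPolynomial (Fin 2 ⊕ Fin 2) ℂ)

/-- Evaluation of the embedded polynomial, given the values of `ι` on generators. [folklore] -/
theorem eval_embed₃ (hC : ∀ a : ℂ, ι (Polynomial.C (Polynomial.C (Polynomial.C a))) = MvPolynomial.C a)
    (h0 : ι (Polynomial.C (Polynomial.C Polynomial.X)) = MvPolynomial.X (Sum.inl 0))
    (h1 : ι (Polynomial.C Polynomial.X) = MvPolynomial.X (Sum.inl 1))
    (h2 : ι Polynomial.X = MvPolynomial.X (Sum.inr 0)) (w : Fin 2 ⊕ Fin 2 → ℂ)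
    (G : Polynomial ℂ[X][X]) :
    MvPolynomial.eval w (ι G) = (G.map (Polynomial.eval₂RingHom
      (Polynomial.evalRingHom (w (Sum.inl 0))) (w (Sum.inl 1)))).eval (w (Sum.inr 0)) := by
  -- three nested `ringHom_ext`
  have e₁ : (MvPolynomial.eval w).comp (ι.comp (Polynomial.C.comp Polynomial.C)) =
      Polynomial.evalRingHom (w (Sum.inl 0)) := by
    refine Polynomial.ringHom_ext (fun a => ?_) ?_
    · simp only [RingHom.comp_apply, hC, MvPolynomial.eval_C, Polynomial.coe_evalRingHom,
        Polynomial.eval_C]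
    · simp only [RingHom.comp_apply, h0, MvPolynomial.eval_X, Polynomial.coe_evalRingHom,
        Polynomial.eval_X]
  have e₂ : (MvPolynomial.eval w).comp (ι.comp Polynomial.C) =
      Polynomial.eval₂RingHom (Polynomial.evalRingHom (w (Sum.inl 0))) (w (Sum.inl 1)) := by
    refine Polynomial.ringHom_ext (fun g => ?_) ?_
    · have h := congrArg (fun f : ℂ[X] →+* ℂ => f g) e₁
      simp only [RingHom.comp_apply] at h
      rw [RingHom.comp_apply, RingHom.comp_apply, h]
      simp only [Polynomial.coe_eval₂RingHom, Polynomial.eval₂_C]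
    · simp only [RingHom.comp_apply, h1, MvPolynomial.eval_X, Polynomial.coe_eval₂RingHom,
        Polynomial.eval₂_X]
  have e₃ : (MvPolynomial.eval w).comp ι = Polynomial.eval₂RingHom
      (Polynomial.eval₂RingHom (Polynomial.evalRingHom (w (Sum.inl 0))) (w (Sum.inl 1)))
      (w (Sum.inr 0)) := by
    refine Polynomial.ringHom_ext (fun g => ?_) ?_
    · have h := congrArg (fun f : ℂ[X][X] →+* ℂ => f g) e₂
      simp only [RingHom.comp_apply] at h
      rw [RingHom.comp_apply, h]
      simp only [Polynomial.coe_eval₂RingHom, Polynomial.eval₂_C]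
    · simp only [RingHom.comp_apply, h2, MvPolynomial.eval_X, Polynomial.coe_eval₂RingHom,
        Polynomial.eval₂_X]
  have h := congrArg (fun f : Polynomial ℂ[X][X] →+* ℂ => f G) e₃
  simp only [RingHom.comp_apply] at h
  rw [h, Polynomial.coe_eval₂RingHom, Polynomial.eval_map]

/-- **`ℂ[x₀, x₁, y₀, y₁] = ℂ[x₀][x₁][y₀][y₁]`**: every polynomial in the four variables is
`Σ_m ι(G_m)·y₁^m`. [folklore] -/
theorem exists_embed₃_poly (hC : ∀ a : ℂ, ι (Polynomial.C (Polynomial.C (Polynomial.C a))) = MvPolynomial.C a)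
    (h0 : ι (Polynomial.C (Polynomial.C Polynomial.X)) = MvPolynomial.X (Sum.inl 0))
    (h1 : ι (Polynomial.C Polynomial.X) = MvPolynomial.X (Sum.inl 1))
    (h2 : ι Polynomial.X = MvPolynomial.X (Sum.inr 0)) (G : MvPolynomial (Fin 2 ⊕ Fin 2) ℂ) :
    ∃ Gy : Polynomial (Polynomial ℂ[X][X]),
      Polynomial.eval₂ ι (MvPolynomial.X (Sum.inr 1)) Gy = G := by
  induction G using MvPolynomial.induction_on with
  | C a =>
    exact ⟨Polynomial.C (Polynomial.C (Polynomial.C (Polynomial.C a))), by rw [Polynomial.eval₂_C, hC]⟩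
  | add p q hp hq =>
    obtain ⟨Gp, hGp⟩ := hp
    obtain ⟨Gq, hGq⟩ := hq
    exact ⟨Gp + Gq, by rw [Polynomial.eval₂_add, hGp, hGq]⟩
  | mul_X p i hp =>
    obtain ⟨Gp, hGp⟩ := hp
    rcases i with i | i <;> fin_cases i
    · refine ⟨Gp * Polynomial.C (Polynomial.C (Polynomial.C Polynomial.X)), ?_⟩
      rw [Polynomial.eval₂_mul, Polynomial.eval₂_C, hGp, h0]; rfl
    · refine ⟨Gp * Polynomial.C (Polynomial.C Polynomial.X), ?_⟩
      rw [Polynomial.eval₂_mul, Polynomial.eval₂_C, hGp, h1]; rfl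
    · refine ⟨Gp * Polynomial.C Polynomial.X, ?_⟩
      rw [Polynomial.eval₂_mul, Polynomial.eval₂_C, hGp, h2]; rfl
    · refine ⟨Gp * Polynomial.X, ?_⟩
      rw [Polynomial.eval₂_mul, Polynomial.eval₂_X, hGp]; rfl

/-- A complex polynomial function `t ↦ Σ_{m ≤ n} a_m t^m` vanishing identically has all
`a_m = 0`. [folklore] -/
theorem coeff_eq_zero_of_forall_sum_eq_zero {n : ℕ} {a : ℕ → ℂ}
    (h : ∀ t : ℂ, ∑ m ∈ Finset.range (n + 1), a m * t ^ m = 0) : ∀ m, m ≤ n → a m = 0 := by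
  classical
  have hp : (∑ m ∈ Finset.range (n + 1), Polynomial.C (a m) * Polynomial.X ^ m : ℂ[X]) = 0 := by
    refine Polynomial.funext fun t => ?_
    rw [eval_rowPoly, Polynomial.eval_zero]
    exact h t
  intro m hm
  have hc := congrArg (fun p : ℂ[X] => p.coeff m) hp
  simp only [coeff_rowPoly, Polynomial.coeff_zero, if_pos (Nat.lt_succ_of_le hm)] at hc
  exact hc

/-! ## Part B. The cylinder theorem (curves that are not lines) -/

variable (F : ℂ[X][X])

/-- **Cylinders of the case over a curve over `ℚ̄` (not a line): dense.**  `F ∈ ℚ̄[x₀][x₁]`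
irreducible of positive `x₁`-degree and not a line; `W` in Mantova–Masser's case with base curve
`{F = 0}`, invariant under `y₁ ↦ t` and annihilated by some `P ∈ ℂ[x₀][x₁][y₀]` not divisible by
`F` coefficientwise.  Then `W` has Zariski-dense exponential points. [cite: MantovaMasser2023, §1
Further remarks, p. 5 (the question, open in general)] (new) -/
theorem unprojectedDense_of_mmCase_cylinder_of_notLine (hFirr : Irreducible F)
    (hF1 : 1 ≤ F.natDegree)
    (hnl : F.natDegree = 1 → 1 ≤ F.leadingCoeff.natDegree ∨ 2 ≤ (F.coeff 0).natDegree)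
    (halg : ∀ i j, IsAlgebraic ℚ ((F.coeff j).coeff i)) {W : Set (Fin 2 ⊕ Fin 2 → ℂ)}
    (hmm : MMCaseDimPiOneFree W)
    (hbase : MvPolynomial.zeroLocus ℂ (MvPolynomial.vanishingIdeal ℂ (projAdd '' (W ∩ torusLocus ℂ 2))) =
      {x : Fin 2 → ℂ | (F.map (Polynomial.evalRingHom (x 0))).eval (x 1) = 0})
    (hcyl : ∀ w ∈ W, ∀ t : ℂ, Function.update w (Sum.inr 1) t ∈ W)
    (P₀ : Polynomial ℂ[X][X]) (hP₀nd : ∃ j, ¬ F ∣ P₀.coeff j)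
    (hP₀W : ∀ w ∈ W, (P₀.map (Polynomial.eval₂RingHom (Polynomial.evalRingHom (w (Sum.inl 0)))
      (w (Sum.inl 1)))).eval (w (Sum.inr 0)) = 0) :
    UnprojectedDense W := by
  classical
  -- the embedding `ι : ℂ[x₀][x₁][y₀] → ℂ[x₀, x₁, y₀, y₁]`
  set ι : Polynomial ℂ[X][X] →+* MvPolynomial (Fin 2 ⊕ Fin 2) ℂ := Polynomial.eval₂RingHom
    (Polynomial.eval₂RingHom (Polynomial.eval₂RingHom MvPolynomial.C (MvPolynomial.X (Sum.inl 0)))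
      (MvPolynomial.X (Sum.inl 1))) (MvPolynomial.X (Sum.inr 0)) with hι
  have hC : ∀ a : ℂ, ι (Polynomial.C (Polynomial.C (Polynomial.C a))) = MvPolynomial.C a := by
    intro a; simp only [hι, Polynomial.coe_eval₂RingHom, Polynomial.eval₂_C]
  have h0 : ι (Polynomial.C (Polynomial.C Polynomial.X)) = MvPolynomial.X (Sum.inl 0) := by
    simp only [hι, Polynomial.coe_eval₂RingHom, Polynomial.eval₂_C, Polynomial.eval₂_X]
  have h1 : ι (Polynomial.C Polynomial.X) = MvPolynomial.X (Sum.inl 1) := by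
    simp only [hι, Polynomial.coe_eval₂RingHom, Polynomial.eval₂_C, Polynomial.eval₂_X]
  have h2 : ι Polynomial.X = MvPolynomial.X (Sum.inr 0) := by
    simp only [hι, Polynomial.coe_eval₂RingHom, Polynomial.eval₂_X]
  have hev := eval_embed₃ ι hC h0 h1 h2
  -- the prime `𝔭 = I(W)` and its basic elements
  set 𝔭 : Ideal (MvPolynomial (Fin 2 ⊕ Fin 2) ℂ) := MvPolynomial.vanishingIdeal ℂ W with h𝔭
  haveI h𝔭p : 𝔭.IsPrime := hmm.1.2
  have hmem : ∀ G : Polynomial ℂ[X][X], ι G ∈ 𝔭 ↔ ∀ w ∈ W,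
      (G.map (Polynomial.eval₂RingHom (Polynomial.evalRingHom (w (Sum.inl 0)))
        (w (Sum.inl 1)))).eval (w (Sum.inr 0)) = 0 := by
    intro G
    rw [h𝔭, MvPolynomial.mem_vanishingIdeal_iff]
    refine forall₂_congr fun w _ => ?_
    rw [MvPolynomial.aeval_eq_eval, hev]
  obtain ⟨w₀, hw₀W, hw₀T⟩ := hmm.2.1
  -- `y₀ ∉ 𝔭`, `y₁ ∉ 𝔭`
  have hy : ∀ i : Fin 2, (MvPolynomial.X (Sum.inr i) : MvPolynomial (Fin 2 ⊕ Fin 2) ℂ) ∉ 𝔭 := by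
    intro i hi
    rw [h𝔭, MvPolynomial.mem_vanishingIdeal_iff] at hi
    have h := hi w₀ hw₀W
    rw [MvPolynomial.aeval_eq_eval, MvPolynomial.eval_X] at h
    exact (mem_torusLocus_iff.1 hw₀T) i h
  have hX : ι Polynomial.X ∉ 𝔭 := by rw [h2]; exact hy 0
  -- `F ∈ 𝔭`
  have hFW : ∀ w ∈ W, w ∈ torusLocus ℂ 2 →
      (F.map (Polynomial.evalRingHom (w (Sum.inl 0)))).eval (w (Sum.inl 1)) = 0 := by
    intro w hwW hwT
    have hcl : projAdd w ∈ MvPolynomial.zeroLocus ℂ (MvPolynomial.vanishingIdeal ℂ (projAdd '' (W ∩ torusLocus ℂ 2))) :=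
      MvPolynomial.zeroLocus_vanishingIdeal_le _ ⟨w, ⟨hwW, hwT⟩, rfl⟩
    rw [hbase] at hcl
    exact hcl
  have hF : ι (Polynomial.C F) ∈ 𝔭 := by
    have hprod : ι (Polynomial.C F) * MvPolynomial.X (Sum.inr 0) * MvPolynomial.X (Sum.inr 1) ∈ 𝔭 := by
      rw [h𝔭, MvPolynomial.mem_vanishingIdeal_iff]
      intro w hwW
      rw [MvPolynomial.aeval_eq_eval, map_mul, map_mul, hev, MvPolynomial.eval_X, MvPolynomial.eval_X,
        Polynomial.map_C, Polynomial.eval_C, Polynomial.coe_eval₂RingHom, Polynomial.eval₂_eq_eval_map]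
      by_cases hwT : w ∈ torusLocus ℂ 2
      · rw [hFW w hwW hwT, zero_mul, zero_mul]
      · rw [mem_torusLocus_iff] at hwT
        push Not at hwT
        obtain ⟨i, hi⟩ := hwT
        fin_cases i
        · simp only [Fin.zero_eta] at hi; rw [hi, mul_zero, zero_mul]
        · simp only [Fin.mk_one] at hi; rw [hi, mul_zero]
    rcases h𝔭p.mem_or_mem hprod with h | h
    · exact (h𝔭p.mem_or_mem h).elim id fun h' => (hy 0 h').elim
    · exact (hy 1 h).elim
  -- `𝔭 ∩ ℂ[x₀][x₁] = (F)`
  obtain ⟨Φr, hΦr⟩ := exists_rowsEquiv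
  set A : MvPolynomial (Fin 2) ℂ := Φr.symm F with hA
  have hPQ : ∀ x y : ℂ, MvPolynomial.eval ![x, y] A = (F.map (Polynomial.evalRingHom x)).eval y := by
    intro x y; rw [hΦr, hA, RingEquiv.apply_symm_apply]
  have hirrA : Irreducible A := (irreducible_rows_iff hPQ).2 hFirr
  have hprimeA : Prime A := UniqueFactorizationMonoid.irreducible_iff_prime.1 hirrA
  haveI : (Ideal.span {A} : Ideal (MvPolynomial (Fin 2) ℂ)).IsPrime :=
    (Ideal.span_singleton_prime hprimeA.ne_zero).2 hprimeA
  have hbaseA : MvPolynomial.zeroLocus ℂ (MvPolynomial.vanishingIdeal ℂ (projAdd '' (W ∩ torusLocus ℂ 2))) =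
      MvPolynomial.zeroLocus ℂ (Ideal.span {A} : Ideal (MvPolynomial (Fin 2) ℂ)) := by
    rw [hbase]
    ext x
    rw [Set.mem_setOf_eq, MvPolynomial.mem_zeroLocus_iff]
    constructor
    · intro hx p hp
      obtain ⟨c, rfl⟩ := Ideal.mem_span_singleton.1 hp
      rw [MvPolynomial.aeval_eq_eval, map_mul]
      have : MvPolynomial.eval x A = 0 := by
        have e : x = ![x 0, x 1] := by funext i; fin_cases i <;> rfl
        rw [e, hPQ]; exact hx
      rw [this, zero_mul]
    · intro hx
      have h := hx A (Ideal.mem_span_singleton_self A)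
      rw [MvPolynomial.aeval_eq_eval] at h
      have e : x = ![x 0, x 1] := by funext i; fin_cases i <;> rfl
      rw [e, hPQ] at h
      exact h
  have hconst : ∀ G : ℂ[X][X], ι (Polynomial.C G) ∈ 𝔭 → F ∣ G := by
    intro G hG
    rw [hmem] at hG
    -- `Φr⁻¹ G` vanishes on `π(W ∩ G²)`, hence on its closure `Z(A)`, hence `A ∣ Φr⁻¹ G`
    have hG' : Φr.symm G ∈ MvPolynomial.vanishingIdeal ℂ (projAdd '' (W ∩ torusLocus ℂ 2)) := by
      rw [MvPolynomial.mem_vanishingIdeal_iff]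
      rintro _ ⟨w, ⟨hwW, -⟩, rfl⟩
      rw [MvPolynomial.aeval_eq_eval]
      have e : projAdd w = ![w (Sum.inl 0), w (Sum.inl 1)] := by funext i; fin_cases i <;> rfl
      rw [e, hΦr, RingEquiv.apply_symm_apply]
      have h := hG w hwW
      rwa [Polynomial.map_C, Polynomial.eval_C, Polynomial.coe_eval₂RingHom,
        Polynomial.eval₂_eq_eval_map] at h
    have hG'' : Φr.symm G ∈ MvPolynomial.vanishingIdeal ℂ (MvPolynomial.zeroLocus ℂ (Ideal.span {A} :
        Ideal (MvPolynomial (Fin 2) ℂ))) := by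
      rw [MvPolynomial.mem_vanishingIdeal_iff]
      intro x hx
      rw [← hbaseA] at hx
      exact (MvPolynomial.mem_zeroLocus_iff.1 hx) _ hG'
    rw [MvPolynomial.IsPrime.vanishingIdeal_zeroLocus, Ideal.mem_span_singleton] at hG''
    obtain ⟨c, hc⟩ := hG''
    refine ⟨Φr c, ?_⟩
    have h := congrArg Φr hc
    rwa [RingEquiv.apply_symm_apply, map_mul, hA, RingEquiv.apply_symm_apply] at h
  -- the minimal fibre polynomial
  have hP₀ : ι P₀ ∈ 𝔭 := (hmem P₀).2 hP₀W
  obtain ⟨P, hP, hd, htop, hbot, hdisc, hdiv⟩ :=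
    exists_fibreMinimalPolynomial (ι := ι) (𝔭 := 𝔭) hFirr hF hconst hX hP₀ hP₀nd
  -- every `G ∈ 𝔭` vanishes at the new points
  have hWcl : W = MvPolynomial.zeroLocus ℂ 𝔭 := eq_zeroLocus_vanishingIdeal_of_isZariskiClosed hmm.1.1
  refine unprojectedDense_fibreCurve_algebraicCurve F hFirr hF1 hnl halg P hd htop hbot hdisc
    P.leadingCoeff htop hmm.1 (le_of_eq hmm.2.2.1) ?_
  intro x₀ x₁ y hFx hlc hy0 hPy
  rw [hWcl, MvPolynomial.mem_zeroLocus_iff]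
  intro G hG
  obtain ⟨Gy, hGy⟩ := exists_embed₃_poly ι hC h0 h1 h2 G
  set pt : Fin 2 ⊕ Fin 2 → ℂ := Sum.elim ![x₀, x₁] ![y, Complex.exp x₁] with hpt
  -- the `y₁`-coefficients of `G` lie in `𝔭` (cylinder)
  have hcoef : ∀ m, ι (Gy.coeff m) ∈ 𝔭 := by
    intro m
    rw [h𝔭, MvPolynomial.mem_vanishingIdeal_iff]
    intro w hwW
    rw [MvPolynomial.aeval_eq_eval]
    -- `t ↦ G(update w y₁ t)` is the polynomial `Σ_m ι(Gy_m)(w) t^m ≡ 0`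
    have hsum : ∀ t : ℂ, ∑ m ∈ Finset.range (Gy.natDegree + 1),
        MvPolynomial.eval w (ι (Gy.coeff m)) * t ^ m = 0 := by
      intro t
      have hGt : MvPolynomial.eval (Function.update w (Sum.inr 1) t) G = 0 := by
        have h := (MvPolynomial.mem_vanishingIdeal_iff.1 hG) _ (hcyl w hwW t)
        rwa [MvPolynomial.aeval_eq_eval] at h
      rw [← hGy, Polynomial.eval₂_eq_sum_range, map_sum] at hGt
      rw [← hGt]
      refine Finset.sum_congr rfl fun m _ => ?_
      rw [map_mul, map_pow, MvPolynomial.eval_X, Function.update_self, hev, hev]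
      simp only [Function.update_of_ne (show (Sum.inl 0 : Fin 2 ⊕ Fin 2) ≠ Sum.inr 1 by decide),
        Function.update_of_ne (show (Sum.inl 1 : Fin 2 ⊕ Fin 2) ≠ Sum.inr 1 by decide),
        Function.update_of_ne (show (Sum.inr 0 : Fin 2 ⊕ Fin 2) ≠ Sum.inr 1 by decide)]
    by_cases hm : m ≤ Gy.natDegree
    · exact coeff_eq_zero_of_forall_sum_eq_zero hsum m hm
    · rw [Polynomial.coeff_eq_zero_of_natDegree_lt (by omega), map_zero, map_zero]
  -- each coefficient vanishes at `(x₀, x₁, y)` by division modulo `F`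
  have hcoef0 : ∀ m, MvPolynomial.eval pt (ι (Gy.coeff m)) = 0 := by
    intro m
    obtain ⟨k, Q, H, hQH, hH⟩ := hdiv _ (hcoef m)
    obtain ⟨H₁, rfl⟩ := (Polynomial.C_dvd_iff_dvd_coeff F H).2 hH
    have h := congrArg (fun T : Polynomial ℂ[X][X] => (T.map (Polynomial.eval₂RingHom
      (Polynomial.evalRingHom x₀) x₁)).eval y) hQH
    simp only [Polynomial.map_mul, Polynomial.map_pow, Polynomial.map_C, Polynomial.map_add,
      Polynomial.eval_mul, Polynomial.eval_pow, Polynomial.eval_C, Polynomial.eval_add,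
      Polynomial.coe_eval₂RingHom, Polynomial.eval₂_eq_eval_map] at h
    rw [hPy, hFx, mul_zero, zero_mul, add_zero] at h
    rw [hev]
    simp only [hpt, Sum.elim_inl, Sum.elim_inr, Matrix.cons_val_zero, Matrix.cons_val_one]
    exact (mul_eq_zero.1 h).resolve_left (pow_ne_zero _ hlc)
  rw [MvPolynomial.aeval_eq_eval, ← hGy, Polynomial.eval₂_eq_sum_range, map_sum]
  refine Finset.sum_eq_zero fun m _ => ?_
  rw [map_mul, hcoef0 m, zero_mul]

/-! ## Part C. Every curve over `ℚ̄` (lines included) -/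

/-- **EVERY CYLINDER OF THE CASE OVER A CURVE DEFINED OVER `ℚ̄` IS DENSE.**  For every irreducible
`F ∈ ℚ̄[x₀][x₁]` and every `W` of Mantova–Masser's case with base curve `{F = 0}` that is
invariant under `y₁ ↦ t` and annihilated by some `P ∈ ℂ[x₀][x₁][y₀]` not divisible by `F`
coefficientwise: the unprojected exponential points are Zariski dense in `W`.  (Vertical lines
and lines of rational slope are excluded by the case; other lines: gen 18, every surface; every
other curve: `unprojectedDense_of_mmCase_cylinder_of_notLine`.) [cite: MantovaMasser2023, §1
Further remarks, p. 5 (the question, open in general)] (new) -/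
theorem unprojectedDense_of_mmCase_cylinder_algebraic (hFirr : Irreducible F)
    (halg : ∀ i j, IsAlgebraic ℚ ((F.coeff j).coeff i)) {W : Set (Fin 2 ⊕ Fin 2 → ℂ)}
    (hmm : MMCaseDimPiOneFree W)
    (hbase : MvPolynomial.zeroLocus ℂ (MvPolynomial.vanishingIdeal ℂ (projAdd '' (W ∩ torusLocus ℂ 2))) =
      {x : Fin 2 → ℂ | (F.map (Polynomial.evalRingHom (x 0))).eval (x 1) = 0})
    (hcyl : ∀ w ∈ W, ∀ t : ℂ, Function.update w (Sum.inr 1) t ∈ W)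
    (P₀ : Polynomial ℂ[X][X]) (hP₀nd : ∃ j, ¬ F ∣ P₀.coeff j)
    (hP₀W : ∀ w ∈ W, (P₀.map (Polynomial.eval₂RingHom (Polynomial.evalRingHom (w (Sum.inl 0)))
      (w (Sum.inl 1)))).eval (w (Sum.inr 0)) = 0) :
    UnprojectedDense W := by
  classical
  have hnotRat := hmm.2.2.2.2
  rw [hbase] at hnotRat
  by_cases hF1 : 1 ≤ F.natDegree
  · by_cases hnl : F.natDegree = 1 → 1 ≤ F.leadingCoeff.natDegree ∨ 2 ≤ (F.coeff 0).natDegree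
    · exact unprojectedDense_of_mmCase_cylinder_of_notLine F hFirr hF1 hnl halg hmm hbase hcyl P₀
        hP₀nd hP₀W
    · -- the curve is a line `x₁ = a x₀ + b` (gen 18: every surface of the case is dense)
      push Not at hnl
      obtain ⟨h1, hlc, hb⟩ := hnl
      have hlc' : F.leadingCoeff = F.coeff 1 := by rw [Polynomial.leadingCoeff, h1]
      have hcdeg : (F.coeff 1).natDegree = 0 := by rw [← hlc']; omega
      obtain ⟨c, hc⟩ : ∃ c : ℂ, F.coeff 1 = Polynomial.C c :=
        ⟨_, Polynomial.eq_C_of_natDegree_eq_zero hcdeg⟩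
      have hc0 : c ≠ 0 := by
        rintro rfl
        rw [map_zero, ← hlc'] at hc
        exact (Polynomial.leadingCoeff_ne_zero.2 hFirr.ne_zero) hc
      have hℓ : F.coeff 0 = Polynomial.C ((F.coeff 0).coeff 1) * Polynomial.X +
          Polynomial.C ((F.coeff 0).coeff 0) :=
        Polynomial.eq_X_add_C_of_natDegree_le_one (by omega)
      set a : ℂ := -(F.coeff 0).coeff 1 / c with ha
      set b : ℂ := -(F.coeff 0).coeff 0 / c with hb'
      refine unprojectedDense_of_mmCase_of_base_eq_line a b hmm ?_
      rw [hbase]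
      ext x
      simp only [Set.mem_setOf_eq, eval_of_natDegree_eq_one F h1, hc, Polynomial.eval_C]
      rw [hℓ, Polynomial.eval_add, Polynomial.eval_mul, Polynomial.eval_C, Polynomial.eval_X,
        Polynomial.eval_C, ha, hb']
      constructor
      · intro h; field_simp; linear_combination h
      · intro h; field_simp at h; linear_combination h
  · -- `x₁`-degree `0`: a vertical line, of rational slope — excluded by the case
    exfalso
    apply hnotRat
    have h0 : F.natDegree = 0 := by omega
    have hFC : F = Polynomial.C (F.coeff 0) := Polynomial.eq_C_of_natDegree_eq_zero h0
    have hfirr : Irreducible (F.coeff 0) := irreducible_of_irreducible_C (by rw [← hFC]; exact hFirr)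
    have hf0 : F.coeff 0 ≠ 0 := hfirr.ne_zero
    obtain ⟨r, hr⟩ := Complex.exists_root
      (Polynomial.degree_pos_of_ne_zero_of_nonunit hf0 hfirr.not_isUnit)
    have hdeg1 : (F.coeff 0).degree = 1 := Polynomial.degree_eq_one_of_irreducible_of_root hfirr hr
    have hnat1 : (F.coeff 0).natDegree = 1 := Polynomial.natDegree_eq_of_degree_eq_some hdeg1
    have hf : F.coeff 0 = Polynomial.C ((F.coeff 0).coeff 1) * Polynomial.X +
        Polynomial.C ((F.coeff 0).coeff 0) :=
      Polynomial.eq_X_add_C_of_natDegree_le_one (le_of_eq hnat1)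
    have hf1 : (F.coeff 0).coeff 1 ≠ 0 := by
      have : (F.coeff 0).leadingCoeff ≠ 0 := Polynomial.leadingCoeff_ne_zero.2 hf0
      rwa [Polynomial.leadingCoeff, hnat1] at this
    have hev : ∀ x y : ℂ, (F.map (Polynomial.evalRingHom x)).eval y =
        (F.coeff 0).coeff 1 * x + (F.coeff 0).coeff 0 := by
      intro x y
      rw [hFC, Polynomial.map_C, Polynomial.eval_C, Polynomial.coe_evalRingHom,
        Polynomial.coeff_C_zero]
      conv_lhs => rw [hf]
      simp
    refine ⟨![1, 0], by simp, -(F.coeff 0).coeff 0 / (F.coeff 0).coeff 1, ?_⟩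
    ext x
    simp only [Set.mem_setOf_eq, hev, Matrix.cons_val_zero, Matrix.cons_val_one, Int.cast_one,
      Int.cast_zero, one_mul, zero_mul, add_zero]
    constructor
    · intro h; field_simp; linear_combination h
    · intro h; field_simp at h; linear_combination h

end FibreCurveCylinder

end Summit.Schanuel.Schanuel.Theorems
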